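import Summits.CriticalPhenomena.PercolationContinuityZ3.Theorems.PercNearOneGluingNoHeavyRsw3VolumeThreeBall
import Summits.CriticalPhenomena.PercolationContinuityZ3.Theorems.PercAnnulusCrossingIICPlanarDensityMarkov
import Literature.Probability.Percolation.SecondMomentMethod
import HarnessLib

/-!
# RSW3 lane (P2, gen 19): the VOLUME of the critical cluster, II — the second moment `E|C(0) ∩ (Λ(n) ∖ Λ(n/2))|² ≤ C n^{2d} π(n)³`
# under the ratio inequalities (every `p`), and a thresholded Paley–Zygmund lemma for counting variables

builds on p205010 (kernel theorem, internal audit signed; external expert review pending) — NOT used in this file.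

Cell `prim-rsw3`, prover seat `prim-rsw3-p2` (gen 19), memo `run/shared/lean/prim/rsw3/P2-RSWLITE.md` §26.
Support file (`--supports stmt-CriticalPhenomena-4575`); no definitions, no named facts, no sorries.

EVERY-`p` CORE, part II.  Hypotheses: (R1) `π(j)²·(j/(16n))^{d−1} ≤ A·π(n)²` (`1 ≤ j ≤ n`) and (R2) `π(j) ≤ B·π(n)` (`1 ≤ j ≤ n ≤ 8j`).

* `sum_sq_oneArmProb_shift_le`, `sum_sq_oneArmProb_trunc_le` — re-centring and truncation of the lattice sum of `π²`;
* `sum_sum_real_openConn_inter_le_of_ratio` — SECOND MOMENT on the shell `S = Λ(n) ∖ Λ(⌊n/2⌋)` (`n ≥ 4`):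
  `Σ_{x,y ∈ S} P_p(0 ↔ x, 0 ↔ y) ≤ B³(C₂ + 5^d) · (2n+1)^d · n^d · π_p(n)³` (three-ball bound of part I: `π(⌊n/4⌋)` at the origin,
  `π²` at the pair scale, summed with the lattice sum of `π²`);
* `sq_sub_le_real_gt_card_mul_sum` — THRESHOLDED PALEY–ZYGMUND for a finite family of events `A_i` of a finite measure:
  `(Σ_i μ(A_i) − t·μ(⋃_i A_i))² ≤ μ{t < #{i : A_i}} · Σ_{i,j} μ(A_i ∩ A_j)` when `t·μ(⋃A_i) ≤ Σ_i μ(A_i)` (the tree's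
  `sq_sum_measureReal_le_measureReal_biUnion_mul_sum` is `t = 0`; applied here to the events `A_i ∩ {N > t}`).

References: C. Borgs, J. Chayes, H. Kesten, J. Spencer, *Uniform boundedness of critical crossing probabilities implies hyperscaling*,
Random Structures Algorithms 15 (1999) 368–413 (hyperscaling relations `dρ = δ + 1`, `2 − η = d(δ−1)/(δ+1)` under box-crossing
postulates) [BorgsChayesKestenSpencer1999]; H. Kesten, PTRF 73 (1986), Thm. (8) (volume of the planar IIC) [Kesten1986]; H. Kesten,
Comm. Math. Phys. 109 (1987) (scaling relations) [Kesten1987]; D. Basu, A. Sapozhnikov, ECP 22 (2017), §1 (A2) [BasuSapozhnikov2017ECP];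
R. Lyons, Y. Peres, *Probability on Trees and Networks* (2016), §5.5 (Paley–Zygmund) [LyonsPeres2016]; G. Grimmett, *Percolation*
(1999), §2.2 (disjoint-support independence) [GrimmettPercolation1999]. [folklore]
-/

noncomputable section

namespace Summit.CriticalPhenomena.PercolationContinuityZ3.Theorems

namespace Rsw3

open MeasureTheory Literature.Probability.LatticeModels Literature.Probability.Percolation
open SurfaceTension Crossing SimpleGraph

variable {d : ℕ}

/-! ## The second moment of `|C(0) ∩ (Λ(n) ∖ Λ(m))|` under (R1), (R2) -/

/-- Re-centring: for `x ∈ Λ(n)`, `Σ_{y ∈ Λ(n)} g(‖x − y‖) ≤ Σ_{u ∈ Λ(2n)} g(‖u‖)` for the nonnegative weights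
`g(w) = π_p(⌊(min(m+1,w)−1)/2⌋)²` (`y ↦ x − y` is injective into `Λ(2n)`). [folklore] -/
theorem sum_sq_oneArmProb_shift_le (p : unitInterval) {m n : ℕ} {x : Site d} (hx : x ∈ box d n) :
    ∑ y ∈ box d n, oneArmProb d p ((min (m + 1) (Site.supNorm (x - y)) - 1) / 2) ^ 2 ≤
      ∑ u ∈ box d (2 * n), oneArmProb d p ((min (m + 1) (Site.supNorm u) - 1) / 2) ^ 2 := by
  classical
  have hinj : ∀ y ∈ box d n, ∀ y' ∈ box d n, x - y = x - y' → y = y' := fun y _ y' _ h => sub_right_injective h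
  rw [← Finset.sum_image (f := fun u => oneArmProb d p ((min (m + 1) (Site.supNorm u) - 1) / 2) ^ 2) hinj]
  refine Finset.sum_le_sum_of_subset_of_nonneg ?_ fun u _ _ => sq_nonneg _
  intro u hu
  rw [Finset.mem_image] at hu
  obtain ⟨y, hy, rfl⟩ := hu
  rw [mem_box] at hx hy ⊢
  intro i
  have h1 := hx i
  have h2 := hy i
  simp only [Pi.sub_apply]
  push_cast
  omega

/-- Truncated lattice sum: `Σ_{u ∈ Λ(2n)} π_p(⌊(min(m+1,‖u‖)−1)/2⌋)² ≤ Σ_{u ∈ Λ(m+1)} π_p(⌊(‖u‖−1)/2⌋)² + (4n+1)^d · π_p(⌊m/2⌋)²`.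
[folklore] -/
theorem sum_sq_oneArmProb_trunc_le (p : unitInterval) (m n : ℕ) :
    ∑ u ∈ box d (2 * n), oneArmProb d p ((min (m + 1) (Site.supNorm u) - 1) / 2) ^ 2 ≤
      ∑ u ∈ box d (m + 1), oneArmProb d p ((Site.supNorm u - 1) / 2) ^ 2 +
        ((4 * (n : ℝ) + 1) ^ d) * oneArmProb d p (m / 2) ^ 2 := by
  classical
  set P : Site d → Prop := fun u => Site.supNorm u ≤ m + 1 with hP
  rw [← Finset.sum_filter_add_sum_filter_not (box d (2 * n)) P]
  refine add_le_add ?_ ?_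
  · -- near part: `min = ‖u‖`, and the filter sits inside `Λ(m+1)`
    have hsub : (box d (2 * n)).filter P ⊆ box d (m + 1) := by
      intro u hu
      rw [Finset.mem_filter] at hu
      exact mem_box_iff_supNorm_le.2 hu.2
    calc ∑ u ∈ (box d (2 * n)).filter P, oneArmProb d p ((min (m + 1) (Site.supNorm u) - 1) / 2) ^ 2
        = ∑ u ∈ (box d (2 * n)).filter P, oneArmProb d p ((Site.supNorm u - 1) / 2) ^ 2 := by
          refine Finset.sum_congr rfl fun u hu => ?_
          rw [Finset.mem_filter] at hu
          rw [min_eq_right hu.2]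
      _ ≤ ∑ u ∈ box d (m + 1), oneArmProb d p ((Site.supNorm u - 1) / 2) ^ 2 :=
          Finset.sum_le_sum_of_subset_of_nonneg hsub fun u _ _ => sq_nonneg _
  · -- far part: `min = m + 1`, at most `|Λ(2n)| = (4n+1)^d` terms
    calc ∑ u ∈ (box d (2 * n)).filter (fun u => ¬ P u), oneArmProb d p ((min (m + 1) (Site.supNorm u) - 1) / 2) ^ 2
        = ∑ _u ∈ (box d (2 * n)).filter (fun u => ¬ P u), oneArmProb d p (m / 2) ^ 2 := by
          refine Finset.sum_congr rfl fun u hu => ?_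
          rw [Finset.mem_filter] at hu
          have h : ¬ Site.supNorm u ≤ m + 1 := hu.2
          rw [min_eq_left (by omega), Nat.add_sub_cancel]
      _ = (((box d (2 * n)).filter (fun u => ¬ P u)).card : ℝ) * oneArmProb d p (m / 2) ^ 2 := by
          rw [Finset.sum_const, nsmul_eq_mul]
      _ ≤ ((4 * (n : ℝ) + 1) ^ d) * oneArmProb d p (m / 2) ^ 2 := by
          refine mul_le_mul_of_nonneg_right ?_ (sq_nonneg _)
          have h := Finset.card_le_card (Finset.filter_subset (fun u => ¬ P u) (box d (2 * n)))
          rw [card_box] at h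
          have h' : (((box d (2 * n)).filter (fun u => ¬ P u)).card : ℝ) ≤ ((2 * (2 * n) + 1) ^ d : ℕ) := by
            exact_mod_cast h
          refine h'.trans (le_of_eq ?_)
          push_cast
          ring

/-- **Second moment on the shell** (every `p` satisfying (R1), (R2) with `π_p(1) > 0`; `d ≥ 1`, `n ≥ 4`, `m = ⌊n/2⌋`,
`S = Λ(n) ∖ Λ(m)`): `Σ_{x ∈ S} Σ_{y ∈ S} P_p(0 ↔ x, 0 ↔ y) ≤ C₃ · (2n+1)^d · n^d · π_p(n)³` with
`C₃ = B³ (C₂ + 5^d)`, `C₂ = 2d·A·192^{d−1} + 5^d·A·16^{d−1}/π_p(1)²` — i.e. `E|C(0) ∩ S|² ≤ C n^{2d} π(n)³` (three-ball bound: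
`π(⌊m/2⌋)` at the origin and `π²` at the pair scale, summed with the lattice sum of `π²`).
[cite: BorgsChayesKestenSpencer1999, §1 (hyperscaling relations)] -/
theorem sum_sum_real_openConn_inter_le_of_ratio (hd : 1 ≤ d) (p : unitInterval) {A B : ℝ} (hA : 0 ≤ A) (hB : 0 ≤ B)
    (hR1 : ∀ j n : ℕ, 1 ≤ j → j ≤ n →
      oneArmProb d p j ^ 2 * ((j : ℝ) / (16 * n)) ^ (d - 1) ≤ A * oneArmProb d p n ^ 2)
    (hR2 : ∀ j n : ℕ, 1 ≤ j → j ≤ n → n ≤ 8 * j → oneArmProb d p j ≤ B * oneArmProb d p n)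
    (hπ1 : 0 < oneArmProb d p 1) {n : ℕ} (hn : 4 ≤ n) :
    ∑ x ∈ box d n \ box d (n / 2), ∑ y ∈ box d n \ box d (n / 2),
        (bondPercolation (zdGraph d) p).real (openConn 0 x ∩ openConn 0 y) ≤
      B ^ 3 * ((2 * d * A * (192 : ℝ) ^ (d - 1) + (5 : ℝ) ^ d * (A * (16 : ℝ) ^ (d - 1) / oneArmProb d p 1 ^ 2)) + (5 : ℝ) ^ d) *
        (2 * (n : ℝ) + 1) ^ d * (n : ℝ) ^ d * oneArmProb d p n ^ 3 := by
  classical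
  set m : ℕ := n / 2 with hm
  set C₂ : ℝ := 2 * d * A * (192 : ℝ) ^ (d - 1) + (5 : ℝ) ^ d * (A * (16 : ℝ) ^ (d - 1) / oneArmProb d p 1 ^ 2) with hC₂
  have hm2 : 1 ≤ m / 2 := by omega
  have hm2n : m / 2 ≤ n := by omega
  have hn8 : n ≤ 8 * (m / 2) := by omega
  have hm1n : m + 1 ≤ n := by omega
  have hm11 : 1 ≤ m + 1 := by omega
  have hn0 : (0 : ℝ) < n := by exact_mod_cast (by omega : 0 < n)
  have hn1 : (1 : ℝ) ≤ n := by exact_mod_cast (by omega : 1 ≤ n)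
  have hd0 : (0 : ℝ) < d := by exact_mod_cast (by omega : 0 < d)
  have hC₂0 : 0 ≤ C₂ := by positivity
  have hπn0 : 0 ≤ oneArmProb d p n := measureReal_nonneg
  -- (R2) at the two radii
  have hπa : oneArmProb d p (m / 2) ≤ B * oneArmProb d p n := hR2 (m / 2) n hm2 hm2n hn8
  have hπm1 : oneArmProb d p (m + 1) ≤ B * oneArmProb d p n :=
    (DCT16.real_siteToBoundary_antitone p (by omega : m / 2 ≤ m + 1)).trans hπa
  have hπa0 : 0 ≤ oneArmProb d p (m / 2) := measureReal_nonneg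
  have hπm10 : 0 ≤ oneArmProb d p (m + 1) := measureReal_nonneg
  -- the inner sum, uniformly in `x ∈ Λ(n)`
  have hinner : ∀ x ∈ box d n,
      ∑ y ∈ box d n \ box d m, oneArmProb d p ((min (m + 1) (Site.supNorm (x - y)) - 1) / 2) ^ 2 ≤
        (C₂ + (5 : ℝ) ^ d) * B ^ 2 * (n : ℝ) ^ d * oneArmProb d p n ^ 2 := by
    intro x hx
    have h1 := sum_sq_oneArmProb_le_of_ratio hd p hA hR1 hπ1 hm11
    have h2 : ((m + 1 : ℕ) : ℝ) ^ d * oneArmProb d p (m + 1) ^ 2 ≤ (n : ℝ) ^ d * (B * oneArmProb d p n) ^ 2 :=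
      mul_le_mul (pow_le_pow_left₀ (by positivity) (by exact_mod_cast hm1n) d) (pow_le_pow_left₀ hπm10 hπm1 2)
        (sq_nonneg _) (by positivity)
    have h3 : (4 * (n : ℝ) + 1) ^ d * oneArmProb d p (m / 2) ^ 2 ≤ ((5 : ℝ) * n) ^ d * (B * oneArmProb d p n) ^ 2 :=
      mul_le_mul (pow_le_pow_left₀ (by positivity) (by linarith) d) (pow_le_pow_left₀ hπa0 hπa 2)
        (sq_nonneg _) (by positivity)
    calc ∑ y ∈ box d n \ box d m, oneArmProb d p ((min (m + 1) (Site.supNorm (x - y)) - 1) / 2) ^ 2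
        ≤ ∑ y ∈ box d n, oneArmProb d p ((min (m + 1) (Site.supNorm (x - y)) - 1) / 2) ^ 2 :=
          Finset.sum_le_sum_of_subset_of_nonneg Finset.sdiff_subset fun _ _ _ => sq_nonneg _
      _ ≤ ∑ u ∈ box d (2 * n), oneArmProb d p ((min (m + 1) (Site.supNorm u) - 1) / 2) ^ 2 :=
          sum_sq_oneArmProb_shift_le p hx
      _ ≤ ∑ u ∈ box d (m + 1), oneArmProb d p ((Site.supNorm u - 1) / 2) ^ 2 +
            ((4 * (n : ℝ) + 1) ^ d) * oneArmProb d p (m / 2) ^ 2 := sum_sq_oneArmProb_trunc_le p m n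
      _ ≤ C₂ * ((m + 1 : ℕ) : ℝ) ^ d * oneArmProb d p (m + 1) ^ 2 + ((4 * (n : ℝ) + 1) ^ d) * oneArmProb d p (m / 2) ^ 2 := by
          rw [hC₂]; linarith [h1]
      _ = C₂ * (((m + 1 : ℕ) : ℝ) ^ d * oneArmProb d p (m + 1) ^ 2) + ((4 * (n : ℝ) + 1) ^ d) * oneArmProb d p (m / 2) ^ 2 := by
          ring
      _ ≤ C₂ * ((n : ℝ) ^ d * (B * oneArmProb d p n) ^ 2) + ((5 : ℝ) * n) ^ d * (B * oneArmProb d p n) ^ 2 :=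
          add_le_add (mul_le_mul_of_nonneg_left h2 hC₂0) h3
      _ = (C₂ + (5 : ℝ) ^ d) * B ^ 2 * (n : ℝ) ^ d * oneArmProb d p n ^ 2 := by rw [mul_pow]; ring
  -- the pair bound and the outer sum
  have hpair : ∀ x ∈ box d n \ box d m, ∀ y ∈ box d n \ box d m,
      (bondPercolation (zdGraph d) p).real (openConn 0 x ∩ openConn 0 y) ≤
        oneArmProb d p (m / 2) * oneArmProb d p ((min (m + 1) (Site.supNorm (x - y)) - 1) / 2) ^ 2 := by
    intro x hx y hy
    rw [Finset.mem_sdiff] at hx hy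
    exact real_openConn_inter_openConn_le_shell hd p hx.2 hy.2
  have hK0 : 0 ≤ (C₂ + (5 : ℝ) ^ d) * B ^ 2 * (n : ℝ) ^ d * oneArmProb d p n ^ 2 :=
    mul_nonneg (mul_nonneg (mul_nonneg (add_nonneg hC₂0 (pow_nonneg (by norm_num) d)) (sq_nonneg B))
      (pow_nonneg hn0.le d)) (sq_nonneg _)
  calc ∑ x ∈ box d n \ box d m, ∑ y ∈ box d n \ box d m, (bondPercolation (zdGraph d) p).real (openConn 0 x ∩ openConn 0 y)
      ≤ ∑ x ∈ box d n \ box d m, ∑ y ∈ box d n \ box d m,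
          oneArmProb d p (m / 2) * oneArmProb d p ((min (m + 1) (Site.supNorm (x - y)) - 1) / 2) ^ 2 :=
        Finset.sum_le_sum fun x hx => Finset.sum_le_sum fun y hy => hpair x hx y hy
    _ = ∑ x ∈ box d n \ box d m, oneArmProb d p (m / 2) *
          ∑ y ∈ box d n \ box d m, oneArmProb d p ((min (m + 1) (Site.supNorm (x - y)) - 1) / 2) ^ 2 := by
        refine Finset.sum_congr rfl fun x _ => ?_
        rw [Finset.mul_sum]
    _ ≤ ∑ _x ∈ box d n \ box d m, (B * oneArmProb d p n) * ((C₂ + (5 : ℝ) ^ d) * B ^ 2 * (n : ℝ) ^ d * oneArmProb d p n ^ 2) := by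
        refine Finset.sum_le_sum fun x hx => ?_
        exact mul_le_mul hπa (hinner x (Finset.mem_sdiff.1 hx).1)
          (Finset.sum_nonneg fun _ _ => sq_nonneg _) (mul_nonneg hB hπn0)
    _ = ((box d n \ box d m).card : ℝ) * ((B * oneArmProb d p n) * ((C₂ + (5 : ℝ) ^ d) * B ^ 2 * (n : ℝ) ^ d * oneArmProb d p n ^ 2)) := by
        rw [Finset.sum_const, nsmul_eq_mul]
    _ ≤ (2 * (n : ℝ) + 1) ^ d * ((B * oneArmProb d p n) * ((C₂ + (5 : ℝ) ^ d) * B ^ 2 * (n : ℝ) ^ d * oneArmProb d p n ^ 2)) := by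
        refine mul_le_mul_of_nonneg_right ?_ (mul_nonneg (mul_nonneg hB hπn0) hK0)
        have h := Finset.card_le_card (Finset.sdiff_subset (s := box d n) (t := box d m))
        rw [card_box] at h
        have h' : ((box d n \ box d m).card : ℝ) ≤ ((2 * n + 1) ^ d : ℕ) := by exact_mod_cast h
        refine h'.trans (le_of_eq ?_)
        push_cast
        ring
    _ = B ^ 3 * (C₂ + (5 : ℝ) ^ d) * (2 * (n : ℝ) + 1) ^ d * (n : ℝ) ^ d * oneArmProb d p n ^ 3 := by ring

/-! ## A thresholded Paley–Zygmund lemma for counting variables -/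

open Classical in
/-- The count of a finite family of events is the sum of their indicators. [folklore] -/
theorem card_filter_mem_eq_sum_indicator {Ω ι : Type*} (S : Finset ι) (A : ι → Set Ω) (ω : Ω) :
    ((S.filter (fun i => ω ∈ A i)).card : ℝ) = ∑ i ∈ S, (A i).indicator 1 ω := by
  rw [Finset.card_filter]
  push_cast
  refine Finset.sum_congr rfl fun i _ => ?_
  by_cases h : ω ∈ A i
  · simp [h]
  · simp [h]

open Classical in
/-- **Thresholded second-moment (Paley–Zygmund) inequality for a finite family of events.**  For measurable events `A_i`
(`i ∈ S`) of a finite measure `μ`, a level `t ≥ 0` with `t · μ(⋃_i A_i) ≤ Σ_i μ(A_i)`, and the count `N = #{i : A_i}`: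
`(Σ_i μ(A_i) − t·μ(⋃_i A_i))² ≤ μ{t < N} · Σ_{i,j} μ(A_i ∩ A_j)`.
Proof: `E[N; N ≤ t] ≤ t·μ(⋃A_i)` (on `{0 < N}` we are in the union), so `E[N; N > t] ≥ Σ_i μ(A_i) − tμ(⋃A_i) ≥ 0`, and
`E[N; N > t]² ≤ μ{N > t}·E[N²]` is the Cauchy–Schwarz step of the tree's `sq_sum_measureReal_le_measureReal_biUnion_mul_sum`
applied to the events `A_i ∩ {N > t}`.  (`t = 0` is Lyons–Peres' Prop. 5.11.) [cite: LyonsPeres2016, §5.5 (Paley–Zygmund inequality)] -/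
theorem sq_sub_le_real_gt_card_mul_sum {Ω ι : Type*} [MeasurableSpace Ω] (μ : Measure Ω) [IsFiniteMeasure μ]
    (S : Finset ι) (A : ι → Set Ω) (hA : ∀ i ∈ S, MeasurableSet (A i)) {t : ℝ} (ht : 0 ≤ t)
    (hle : t * μ.real (⋃ i ∈ S, A i) ≤ ∑ i ∈ S, μ.real (A i)) :
    (∑ i ∈ S, μ.real (A i) - t * μ.real (⋃ i ∈ S, A i)) ^ 2 ≤
      μ.real {ω | t < ((S.filter (fun i => ω ∈ A i)).card : ℝ)} * ∑ i ∈ S, ∑ j ∈ S, μ.real (A i ∩ A j) := by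
  classical
  set U : Set Ω := ⋃ i ∈ S, A i with hU
  set f : Ω → ℝ := fun ω => ∑ i ∈ S, (A i).indicator 1 ω with hf
  set E : Set Ω := {ω | t < ((S.filter (fun i => ω ∈ A i)).card : ℝ)} with hE
  have hEf : E = {ω | t < f ω} := by
    ext ω; rw [hE, Set.mem_setOf_eq, Set.mem_setOf_eq, card_filter_mem_eq_sum_indicator]
  have hind : ∀ s : Set Ω, MeasurableSet s → Integrable (s.indicator (1 : Ω → ℝ)) μ :=
    fun s hs => (integrable_const (1 : ℝ)).indicator hs
  have hfm : Measurable f := Finset.measurable_sum _ fun i hi => measurable_const.indicator (hA i hi)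
  have hEm : MeasurableSet E := by rw [hEf]; exact measurableSet_lt measurable_const hfm
  -- (1) the Cauchy–Schwarz step for the events `A_i ∩ E`
  have hmeas' : ∀ i ∈ S, MeasurableSet (A i ∩ E) := fun i hi => (hA i hi).inter hEm
  have hCS := sq_sum_measureReal_le_measureReal_biUnion_mul_sum μ S (fun i => A i ∩ E) hmeas'
  have hUE : μ.real (⋃ i ∈ S, A i ∩ E) ≤ μ.real E :=
    measureReal_mono (Set.iUnion₂_subset fun i _ => Set.inter_subset_right) (measure_ne_top _ _)
  have hSS : ∑ i ∈ S, ∑ j ∈ S, μ.real (A i ∩ E ∩ (A j ∩ E)) ≤ ∑ i ∈ S, ∑ j ∈ S, μ.real (A i ∩ A j) :=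
    Finset.sum_le_sum fun i _ => Finset.sum_le_sum fun j _ =>
      measureReal_mono (fun ω hω => ⟨hω.1.1, hω.2.1⟩) (measure_ne_top _ _)
  -- (2) the first-moment split: `Σ_i μ(A_i ∖ E) ≤ t μ(U)`
  have hsplit : ∀ i ∈ S, μ.real (A i) = μ.real (A i ∩ E) + μ.real (A i \ E) :=
    fun i hi => (measureReal_inter_add_sdiff hEm (measure_ne_top _ _)).symm
  have hlow : ∑ i ∈ S, μ.real (A i \ E) ≤ t * μ.real U := by
    have hint : ∫ ω, (∑ i ∈ S, (A i \ E).indicator (1 : Ω → ℝ) ω) ∂μ = ∑ i ∈ S, μ.real (A i \ E) := by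
      rw [integral_finsetSum _ (fun i hi => hind _ ((hA i hi).diff hEm))]
      exact Finset.sum_congr rfl fun i hi => integral_indicator_one ((hA i hi).diff hEm)
    have hintU : ∫ ω, t * U.indicator (1 : Ω → ℝ) ω ∂μ = t * μ.real U := by
      rw [integral_const_mul, integral_indicator_one (Finset.measurableSet_biUnion S hA)]
    have hpt : ∀ ω, (∑ i ∈ S, (A i \ E).indicator (1 : Ω → ℝ) ω) ≤ t * U.indicator (1 : Ω → ℝ) ω := by
      intro ω
      by_cases hω : ω ∈ E
      · have h0 : (∑ i ∈ S, (A i \ E).indicator (1 : Ω → ℝ) ω) = 0 :=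
          Finset.sum_eq_zero fun i _ => Set.indicator_of_notMem (fun h => h.2 hω) _
        rw [h0]
        exact mul_nonneg ht (Set.indicator_nonneg (fun _ _ => zero_le_one) _)
      · -- off `E` the count is `≤ t`; if it is positive we are in `U`
        have hle' : ((S.filter (fun i => ω ∈ A i)).card : ℝ) ≤ t := by
          rw [hE, Set.mem_setOf_eq, not_lt] at hω; exact hω
        have heq : (∑ i ∈ S, (A i \ E).indicator (1 : Ω → ℝ) ω) = ((S.filter (fun i => ω ∈ A i)).card : ℝ) := by
          rw [card_filter_mem_eq_sum_indicator]
          refine Finset.sum_congr rfl fun i _ => ?_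
          by_cases h : ω ∈ A i
          · rw [Set.indicator_of_mem (show ω ∈ A i \ E from ⟨h, hω⟩), Set.indicator_of_mem h]
          · rw [Set.indicator_of_notMem (fun h' => h h'.1), Set.indicator_of_notMem h]
        rw [heq]
        by_cases hpos : (S.filter (fun i => ω ∈ A i)).card = 0
        · rw [hpos, Nat.cast_zero]
          exact mul_nonneg ht (Set.indicator_nonneg (fun _ _ => zero_le_one) _)
        · obtain ⟨i, hi⟩ := Finset.card_pos.1 (Nat.pos_of_ne_zero hpos)
          rw [Finset.mem_filter] at hi
          have hωU : ω ∈ U := Set.mem_iUnion₂.2 ⟨i, hi.1, hi.2⟩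
          rw [Set.indicator_of_mem hωU, Pi.one_apply, mul_one]
          exact hle'
    have h1 : Integrable (fun ω => ∑ i ∈ S, (A i \ E).indicator (1 : Ω → ℝ) ω) μ :=
      integrable_finsetSum _ fun i hi => hind _ ((hA i hi).diff hEm)
    have h2 : Integrable (fun ω => t * U.indicator (1 : Ω → ℝ) ω) μ := (hind _ (Finset.measurableSet_biUnion S hA)).const_mul t
    rw [← hint, ← hintU]
    exact integral_mono h1 h2 hpt
  -- (3) assemble
  have hsum : ∑ i ∈ S, μ.real (A i) = ∑ i ∈ S, μ.real (A i ∩ E) + ∑ i ∈ S, μ.real (A i \ E) := by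
    rw [← Finset.sum_add_distrib]; exact Finset.sum_congr rfl hsplit
  have hm : ∑ i ∈ S, μ.real (A i) - t * μ.real U ≤ ∑ i ∈ S, μ.real (A i ∩ E) := by linarith
  have hm0 : 0 ≤ ∑ i ∈ S, μ.real (A i) - t * μ.real U := by linarith
  have hS0 : 0 ≤ ∑ i ∈ S, ∑ j ∈ S, μ.real (A i ∩ A j) :=
    Finset.sum_nonneg fun _ _ => Finset.sum_nonneg fun _ _ => measureReal_nonneg
  calc (∑ i ∈ S, μ.real (A i) - t * μ.real U) ^ 2 ≤ (∑ i ∈ S, μ.real (A i ∩ E)) ^ 2 := pow_le_pow_left₀ hm0 hm 2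
    _ ≤ μ.real (⋃ i ∈ S, A i ∩ E) * ∑ i ∈ S, ∑ j ∈ S, μ.real (A i ∩ E ∩ (A j ∩ E)) := hCS
    _ ≤ μ.real E * ∑ i ∈ S, ∑ j ∈ S, μ.real (A i ∩ A j) :=
        mul_le_mul hUE hSS (Finset.sum_nonneg fun _ _ => Finset.sum_nonneg fun _ _ => measureReal_nonneg) measureReal_nonneg

end Rsw3

end Summit.CriticalPhenomena.PercolationContinuityZ3.Theorems
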